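import Summits.Ventures.Crystal3D.Bulk.GapVertexSectors
import Summits.Ventures.Crystal3D.Bulk.GapTwoConnected
import HarnessLib

/-!
# P-L3(g), second clause: two distinct faces of the tight map meet in ∅, ONE vertex, or ONE
# edge (with its two endpoints) — regions-free, from the local STEP 1 of `Bulk/GapVertexSectors`

HONEST FRAMING. Part of the venture `Summits/Ventures/Crystal3D` (cell `pub-crystal3d`, phase 2;
seat typer-bulk-2). Kernel theorems about every configuration satisfying `CensusRows c`; nothing is
claimed about GAP(1.26). The cell's `DESIGN-L12-THEORY.md` §P-L3(g) STEP 1 reads: «two distinct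
faces with two common vertices `u ≠ v` are the two sides of the edge `uv`; two faces never share
three vertices». Faces are the oriented `φ°`-orbits `F ∈ ofaces c` (finsets of darts), the
vertices of `F` are the tails `F.image Prod.fst`. This file proves, for `F ≠ G` in `ofaces c`:

* `CensusRows.oface_common_vertex` (indexed form at a vertex `v`): if the faces of two darts
  `(a, v)`, `(a', v)` with `a ≠ a'` have a common vertex at walk indices `n, n' ≠ 1`, then
  `{n, n'} = {0, 2}` — the common vertex is `a = onextNbr c v a'` or `a' = onextNbr c v a`;
* **`CensusRows.ofaces_meet`**: two distinct common vertices `x ≠ y` of `F ≠ G` are tight-adjacent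
  and `F`, `G` are the two sides of that edge: `(x, y) ∈ F ∧ (y, x) ∈ G` or `(y, x) ∈ F ∧ (x, y) ∈ G`;
* **`CensusRows.card_common_vertices_le_two`**: `F ≠ G` have at most two common vertices
  (a third would force `onextNbr c x ∘ onextNbr c x = id` on a partner, i.e. degree `≤ 2` at `x`).

* `CensusRows.not_mem_darts_of_oface_diagonal` / `one_lt_dist_of_oface_diagonal` — the «diagonal»
  clause of rows R-pent / R-hex: non-adjacent corners of a face are loose (`1 < dist`).

Tools: `CensusRows.exists_dart_into` (re-basing a face at its dart into a vertex),
`CensusRows.oface_out_unique` / `oface_in_unique` (a face has one dart out of and one dart into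
each of its vertices — distinct vertices, LEMMA L), `CensusRows.onextNbr_onextNbr_ne` (degree
`≥ 3`).
-/

noncomputable section

namespace Summit.Ventures.Crystal3D

open Literature.Geometry.DiscreteGeometry Finset Function

variable {c : Fin 14 → EuclideanSpace ℝ (Fin 3)}

/-! ## Bookkeeping on oriented faces -/

/-- The vertices of the face of a dart `q` are the tails of the walk of `q`. -/
theorem mem_image_fst_ofaceOf {q : Fin 14 × Fin 14} {y : Fin 14} :
    y ∈ (ofaceOf c q).image Prod.fst ↔ ∃ n < ofaceLen c q, ((ofaceSucc c)^[n] q).1 = y := by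
  unfold ofaceOf
  simp only [Finset.mem_image, Finset.mem_range, exists_exists_and_eq_and]

/-- A face is closed under the oriented face successor. -/
theorem CensusRows.ofaceSucc_mem_of_mem_ofaces (h : CensusRows c) {F : Finset (Fin 14 × Fin 14)}
    (hF : F ∈ ofaces c) {q : Fin 14 × Fin 14} (hq : q ∈ F) : ofaceSucc c q ∈ F := by
  obtain ⟨hD3, -, -⟩ := h.intruderDist_bounds
  obtain ⟨q₀, hq₀, rfl⟩ := mem_ofaces_iff.1 hF
  exact ofaceSucc_mem_ofaceOf (h.isGapConfig.mem_periodicPts_ofaceSucc hD3 hq₀) hq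

/-- **Re-basing a face at a vertex**: a vertex `v` of a face `F` is the head of a dart of `F`. -/
theorem CensusRows.exists_dart_into (h : CensusRows c) {F : Finset (Fin 14 × Fin 14)}
    (hF : F ∈ ofaces c) {v : Fin 14} (hv : v ∈ F.image Prod.fst) : ∃ a, (a, v) ∈ F := by
  obtain ⟨hD3, -, -⟩ := h.intruderDist_bounds
  obtain ⟨q, hqF, rfl⟩ := Finset.mem_image.1 hv
  have hFq : ofaceOf c q = F := h.isGapConfig.ofaceOf_eq_of_mem_ofaces hD3 hF hqF
  have hq : q ∈ darts c := h.isGapConfig.subset_darts_of_mem_ofaces hD3 hF hqF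
  have hper := h.isGapConfig.mem_periodicPts_ofaceSucc hD3 hq
  set m := ofaceLen c q with hm
  have hmpos : 0 < m := h.isGapConfig.ofaceLen_pos hD3 hq
  set r := (ofaceSucc c)^[m - 1] q with hr
  have hrF : r ∈ F := by rw [← hFq]; exact iterate_mem_ofaceOf hper _
  have hsucc : ofaceSucc c r = q := by
    have e : (ofaceSucc c)^[m - 1 + 1] q = q := by
      rw [Nat.sub_add_cancel hmpos, hm, iterate_ofaceLen]
    rw [iterate_succ_apply'] at e
    exact e
  have hr2 : r.2 = q.1 := by
    have := congrArg Prod.fst hsucc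
    simpa only [ofaceSucc] using this
  refine ⟨r.1, ?_⟩
  have : r = (r.1, q.1) := by rw [← hr2]
  rw [← this]; exact hrF

/-- **A face has ONE dart out of each of its vertices** (distinct vertices along the walk). -/
theorem CensusRows.oface_out_unique (h : CensusRows c) {F : Finset (Fin 14 × Fin 14)}
    (hF : F ∈ ofaces c) {x y z : Fin 14} (hy : (x, y) ∈ F) (hz : (x, z) ∈ F) : y = z := by
  obtain ⟨hD3, -, -⟩ := h.intruderDist_bounds
  have hFq : ofaceOf c (x, y) = F := h.isGapConfig.ofaceOf_eq_of_mem_ofaces hD3 hF hy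
  have hq : (x, y) ∈ darts c := h.isGapConfig.subset_darts_of_mem_ofaces hD3 hF hy
  have hper := h.isGapConfig.mem_periodicPts_ofaceSucc hD3 hq
  rw [← hFq] at hz
  unfold ofaceOf at hz
  obtain ⟨n, hn, hnz⟩ := Finset.mem_image.1 hz
  rw [Finset.mem_range] at hn
  by_cases hn0 : n = 0
  · subst hn0
    rw [iterate_zero, id_eq] at hnz
    exact (Prod.mk.inj hnz).2
  · exfalso
    have := h.fst_iterate_ofaceSucc_injOn hq (i := 0) (j := n) (by omega) hn
    rw [iterate_zero, id_eq, hnz] at this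
    exact this rfl

/-- **A face has ONE dart into each of its vertices.** -/
theorem CensusRows.oface_in_unique (h : CensusRows c) {F : Finset (Fin 14 × Fin 14)}
    (hF : F ∈ ofaces c) {x y z : Fin 14} (hy : (y, x) ∈ F) (hz : (z, x) ∈ F) : y = z := by
  obtain ⟨hD3, -, -⟩ := h.intruderDist_bounds
  have hFq : ofaceOf c (y, x) = F := h.isGapConfig.ofaceOf_eq_of_mem_ofaces hD3 hF hy
  have hq : (y, x) ∈ darts c := h.isGapConfig.subset_darts_of_mem_ofaces hD3 hF hy
  have hper := h.isGapConfig.mem_periodicPts_ofaceSucc hD3 hq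
  rw [← hFq] at hz
  unfold ofaceOf at hz
  obtain ⟨n, hn, hnz⟩ := Finset.mem_image.1 hz
  rw [Finset.mem_range] at hn
  by_cases hn0 : n = 0
  · subst hn0
    rw [iterate_zero, id_eq] at hnz
    exact (Prod.mk.inj hnz).1
  · exfalso
    -- positions `1` and `n + 1` both start at `x`
    have e1 : ((ofaceSucc c)^[1] (y, x)).1 = x := rfl
    have en : ((ofaceSucc c)^[n + 1] (y, x)).1 = x := by
      rw [iterate_succ_apply', hnz]; rfl
    rcases Nat.lt_or_ge (n + 1) (ofaceLen c (y, x)) with hlt | hge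
    · have := h.fst_iterate_ofaceSucc_injOn hq (i := 1) (j := n + 1) (by omega) hlt
      rw [e1, en] at this
      exact this rfl
    · -- `n + 1 = ofaceLen`: then `φ° (z, x) = (y, x)`, i.e. `x = y`, not a dart
      have heq : n + 1 = ofaceLen c (y, x) := by omega
      have : (ofaceSucc c)^[n + 1] (y, x) = (y, x) := by rw [heq, iterate_ofaceLen]
      rw [this] at en
      exact (mem_darts.1 hq).2.2.1 en

/-- **Degree `≥ 3` in rotation form**: `onextNbr c i (onextNbr c i j) ≠ j` for a tight partner
`j` of `i` (otherwise the rotation at `i`, transitive on the partners, would have only the two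
partners `j`, `onextNbr c i j`). -/
theorem CensusRows.onextNbr_onextNbr_ne (h : CensusRows c) {i j : Fin 14} (hi0 : i ≠ 0)
    (hj : j ∈ tightNbrs c i) : onextNbr c i (onextNbr c i j) ≠ j := by
  classical
  intro h2
  -- every partner is `j` or `onextNbr c i j`
  have horb : ∀ k, (onextNbr c i)^[k] j = j ∨ (onextNbr c i)^[k] j = onextNbr c i j := by
    intro k
    induction k with
    | zero => exact Or.inl rfl
    | succ k ih =>
      rw [iterate_succ_apply']
      rcases ih with e | e <;> rw [e]
      · exact Or.inr rfl
      · exact Or.inl h2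
  have hsub : tightNbrs c i ⊆ {j, onextNbr c i j} := by
    intro w hw
    obtain ⟨k, hk⟩ := h.exists_iterate_onextNbr_eq hi0 hj hw
    rw [Finset.mem_insert, Finset.mem_singleton, ← hk]
    exact horb k
  have hcard : (tightNbrs c i).card ≤ 2 :=
    (Finset.card_le_card hsub).trans (Finset.card_insert_le _ _)
  have hset : (univ.filter fun j : Fin 14 => j ≠ 0 ∧ j ≠ i ∧ dist (c i) (c j) = 1) =
      tightNbrs c i := rfl
  by_cases hi13 : i = 13
  · subst hi13
    have h3 := h.three_le_card_intruderContacts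
    rw [hset] at h3
    omega
  · have h3 := h.three_le_card_tight i hi0 hi13 ⟨j, mem_tightNbrs.1 hj⟩
    rw [hset] at h3
    omega

/-! ## STEP 1 of P-L3(g): indexed form -/

/-- **Two faces at a vertex share only that vertex or an edge at it (indexed form).** For darts
`q = (a, v)`, `q' = (a', v)` with `a ≠ a'` and walk indices `n < ofaceLen c q`, `n' < ofaceLen c q'`,
both `≠ 1` (index `1` is `v` itself): if the `n`-th vertex of the face of `q` equals the `n'`-th
vertex of the face of `q'`, then `(n, n') = (0, 2)` or `(2, 0)` — the common vertex is `a` and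
`a = onextNbr c v a'`, or it is `a'` and `a' = onextNbr c v a`. -/
theorem CensusRows.oface_common_vertex (h : CensusRows c) {q q' : Fin 14 × Fin 14}
    (hq : q ∈ darts c) (hq' : q' ∈ darts c) (hv : q.2 = q'.2) (ha : q.1 ≠ q'.1) {n n' : ℕ}
    (hn : n < ofaceLen c q) (hn1 : n ≠ 1) (hn' : n' < ofaceLen c q') (hn'1 : n' ≠ 1)
    (hx : ((ofaceSucc c)^[n] q).1 = ((ofaceSucc c)^[n'] q').1) :
    (n = 0 ∧ n' = 2) ∨ (n = 2 ∧ n' = 0) := by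
  obtain ⟨hD3, -, -⟩ := h.intruderDist_bounds
  have hv0 : q.2 ≠ 0 := (mem_darts.1 hq).2.1
  have haN : q.1 ∈ tightNbrs c q.2 := by
    have := snd_mem_tightNbrs_of_mem_darts (swap_mem_darts hq)
    simpa only [Prod.fst_swap, Prod.snd_swap] using this
  have haN' : q'.1 ∈ tightNbrs c q.2 := by
    have := snd_mem_tightNbrs_of_mem_darts (swap_mem_darts hq')
    rw [hv]
    simpa only [Prod.fst_swap, Prod.snd_swap] using this
  obtain ⟨-, e2⟩ := fst_iterate_ofaceSucc_two c q
  obtain ⟨-, e2'⟩ := fst_iterate_ofaceSucc_two c q'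
  -- the vertices at indices `0` and `2` are tight partners of `v`
  have low : ∀ {r : Fin 14 × Fin 14}, r ∈ darts c → r.2 = q.2 → ∀ {m : ℕ}, m = 0 ∨ m = 2 →
      ((ofaceSucc c)^[m] r).1 ∈ tightNbrs c q.2 := by
    intro r hr hr2 m hm
    have hrN : r.1 ∈ tightNbrs c r.2 := by
      have := snd_mem_tightNbrs_of_mem_darts (swap_mem_darts hr)
      simpa only [Prod.fst_swap, Prod.snd_swap] using this
    rcases hm with rfl | rfl
    · rw [iterate_zero, id_eq, ← hr2]; exact hrN
    · rw [(fst_iterate_ofaceSucc_two c r).2, ← hr2]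
      exact (h.onextNbr_mem_ne (hr2 ▸ hv0 :) hrN).1
  rcases Nat.lt_or_ge n 3 with hn3 | hn3
  · have hn02 : n = 0 ∨ n = 2 := by omega
    rcases Nat.lt_or_ge n' 3 with hn'3 | hn'3
    · have hn'02 : n' = 0 ∨ n' = 2 := by omega
      rcases hn02 with rfl | rfl <;> rcases hn'02 with rfl | rfl
      · -- `(0, 0)`: `a = a'`
        simp only [iterate_zero, id_eq] at hx
        exact absurd hx ha
      · exact Or.inl ⟨rfl, rfl⟩
      · exact Or.inr ⟨rfl, rfl⟩
      · -- `(2, 2)`: `onextNbr c v a = onextNbr c v a'`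
        rw [e2, e2', ← hv] at hx
        exact absurd (h.isGapConfig.onextNbr_injOn hD3 hv0 haN haN' hx) ha
    · -- `n ∈ {0, 2}`, `n' ≥ 3`: a partner of `v` on the far part of the face of `q'`
      exfalso
      have := h.not_mem_tightNbrs_of_oface hq' hn'3 hn'
      rw [← hx, ← hv] at this
      exact this (low hq rfl hn02)
  · rcases Nat.lt_or_ge n' 3 with hn'3 | hn'3
    · exfalso
      have hn'02 : n' = 0 ∨ n' = 2 := by omega
      have := h.not_mem_tightNbrs_of_oface hq hn3 hn
      rw [hx] at this
      exact this (low hq' hv.symm hn'02)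
    · exact absurd hx (h.oface_vertex_ne_of_ne hq hq' hv ha hn3 hn hn'3 hn')

/-! ## STEP 1 of P-L3(g): two distinct faces meet in ∅ / one vertex / one edge -/

/-- **Two distinct faces with two common vertices are the two sides of the edge joining them.**
For `F ≠ G` in `ofaces c` and common vertices `x ≠ y`: `(x, y) ∈ F ∧ (y, x) ∈ G` or
`(y, x) ∈ F ∧ (x, y) ∈ G` (in particular `x, y` are tight-adjacent). -/
theorem CensusRows.ofaces_meet (h : CensusRows c) {F G : Finset (Fin 14 × Fin 14)}
    (hF : F ∈ ofaces c) (hG : G ∈ ofaces c) (hFG : F ≠ G) {x y : Fin 14} (hxy : x ≠ y)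
    (hxF : x ∈ F.image Prod.fst) (hxG : x ∈ G.image Prod.fst) (hyF : y ∈ F.image Prod.fst)
    (hyG : y ∈ G.image Prod.fst) :
    ((x, y) ∈ F ∧ (y, x) ∈ G) ∨ ((y, x) ∈ F ∧ (x, y) ∈ G) := by
  obtain ⟨hD3, -, -⟩ := h.intruderDist_bounds
  obtain ⟨a, haF⟩ := h.exists_dart_into hF hxF
  obtain ⟨a', haG⟩ := h.exists_dart_into hG hxG
  have hFq : ofaceOf c (a, x) = F := h.isGapConfig.ofaceOf_eq_of_mem_ofaces hD3 hF haF
  have hGq : ofaceOf c (a', x) = G := h.isGapConfig.ofaceOf_eq_of_mem_ofaces hD3 hG haG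
  have hq : (a, x) ∈ darts c := h.isGapConfig.subset_darts_of_mem_ofaces hD3 hF haF
  have hq' : (a', x) ∈ darts c := h.isGapConfig.subset_darts_of_mem_ofaces hD3 hG haG
  have ha : a ≠ a' := by
    rintro rfl
    exact hFG (hFq.symm.trans hGq)
  rw [← hFq] at hyF
  rw [← hGq] at hyG
  obtain ⟨n, hn, hny⟩ := mem_image_fst_ofaceOf.1 hyF
  obtain ⟨n', hn', hn'y⟩ := mem_image_fst_ofaceOf.1 hyG
  have hn1 : n ≠ 1 := by rintro rfl; exact hxy hny
  have hn'1 : n' ≠ 1 := by rintro rfl; exact hxy hn'y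
  have key := h.oface_common_vertex hq hq' rfl ha hn hn1 hn' hn'1 (hny.trans hn'y.symm)
  rcases key with ⟨rfl, rfl⟩ | ⟨rfl, rfl⟩
  · -- `y = a` and `y = onextNbr c x a'`
    right
    rw [iterate_zero, id_eq] at hny
    rw [(fst_iterate_ofaceSucc_two c (a', x)).2] at hn'y
    refine ⟨?_, ?_⟩
    · have : (y, x) = (a, x) := by rw [← hny]
      rw [this]; exact haF
    · have hs := h.ofaceSucc_mem_of_mem_ofaces hG haG
      have : ofaceSucc c (a', x) = (x, y) := by rw [← hn'y]; rfl
      rw [this] at hs; exact hs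
  · left
    rw [iterate_zero, id_eq] at hn'y
    rw [(fst_iterate_ofaceSucc_two c (a, x)).2] at hny
    refine ⟨?_, ?_⟩
    · have hs := h.ofaceSucc_mem_of_mem_ofaces hF haF
      have : ofaceSucc c (a, x) = (x, y) := by rw [← hny]; rfl
      rw [this] at hs; exact hs
    · have : (y, x) = (a', x) := by rw [← hn'y]
      rw [this]; exact haG

/-- Two distinct common vertices of two distinct faces are tight-adjacent. -/
theorem CensusRows.mem_darts_of_common_vertices (h : CensusRows c) {F G : Finset (Fin 14 × Fin 14)}
    (hF : F ∈ ofaces c) (hG : G ∈ ofaces c) (hFG : F ≠ G) {x y : Fin 14} (hxy : x ≠ y)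
    (hxF : x ∈ F.image Prod.fst) (hxG : x ∈ G.image Prod.fst) (hyF : y ∈ F.image Prod.fst)
    (hyG : y ∈ G.image Prod.fst) : (x, y) ∈ darts c := by
  obtain ⟨hD3, -, -⟩ := h.intruderDist_bounds
  rcases h.ofaces_meet hF hG hFG hxy hxF hxG hyF hyG with ⟨hxy', -⟩ | ⟨-, hxy'⟩
  · exact h.isGapConfig.subset_darts_of_mem_ofaces hD3 hF hxy'
  · exact h.isGapConfig.subset_darts_of_mem_ofaces hD3 hG hxy'

/-- **Two distinct faces have at most two common vertices** (so they meet in ∅, one vertex, or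
one edge with its two endpoints). -/
theorem CensusRows.card_common_vertices_le_two (h : CensusRows c)
    {F G : Finset (Fin 14 × Fin 14)} (hF : F ∈ ofaces c) (hG : G ∈ ofaces c) (hFG : F ≠ G) :
    (F.image Prod.fst ∩ G.image Prod.fst).card ≤ 2 := by
  classical
  obtain ⟨hD3, -, -⟩ := h.intruderDist_bounds
  by_contra hlt
  rw [not_le, Finset.two_lt_card] at hlt
  obtain ⟨x, hx, y, hy, z, hz, hxy, hxz, hyz⟩ := hlt
  rw [Finset.mem_inter] at hx hy hz
  -- the rotation at `x`: in `F` the out-dart at `x` follows the in-dart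
  have hx0 : x ≠ 0 := by
    obtain ⟨q, hqF, hqx⟩ := Finset.mem_image.1 hx.1
    rw [← hqx]
    exact (mem_darts.1 (h.isGapConfig.subset_darts_of_mem_ofaces hD3 hF hqF)).1
  have rot : ∀ {H : Finset (Fin 14 × Fin 14)}, H ∈ ofaces c → ∀ {p s : Fin 14},
      (p, x) ∈ H → (x, s) ∈ H → s = onextNbr c x p := by
    intro H hH p s hp hs
    have hsucc := h.ofaceSucc_mem_of_mem_ofaces hH hp
    exact h.oface_out_unique hH hs hsucc
  have nbr : ∀ {p : Fin 14}, (p, x) ∈ darts c → p ∈ tightNbrs c x := by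
    intro p hp
    have := snd_mem_tightNbrs_of_mem_darts (swap_mem_darts hp)
    simpa only [Prod.fst_swap, Prod.snd_swap] using this
  have mxy := h.ofaces_meet hF hG hFG hxy hx.1 hx.2 hy.1 hy.2
  have mxz := h.ofaces_meet hF hG hFG hxz hx.1 hx.2 hz.1 hz.2
  rcases mxy with ⟨hxyF, hyxG⟩ | ⟨hyxF, hxyG⟩ <;> rcases mxz with ⟨hxzF, hzxG⟩ | ⟨hzxF, hxzG⟩
  · exact hyz (h.oface_out_unique hF hxyF hxzF)
  · -- `F: z → x → y`, `G: y → x → z`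
    have e1 := rot hF hzxF hxyF
    have e2 := rot hG hyxG hxzG
    have hzN := nbr (h.isGapConfig.subset_darts_of_mem_ofaces hD3 hF hzxF)
    exact h.onextNbr_onextNbr_ne hx0 hzN (by rw [← e1, ← e2])
  · -- `F: y → x → z`, `G: z → x → y`
    have e1 := rot hF hyxF hxzF
    have e2 := rot hG hzxG hxyG
    have hyN := nbr (h.isGapConfig.subset_darts_of_mem_ofaces hD3 hF hyxF)
    exact h.onextNbr_onextNbr_ne hx0 hyN (by rw [← e1, ← e2])
  · exact hyz (h.oface_in_unique hF hyxF hzxF)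

/-! ## Loose diagonals (the «diagonal» clause of rows R-pent / R-hex) -/

/-- **Diagonals of a face are loose (graph form).** For a face `F`, consecutive darts
`(a, v), (v, b) ∈ F` and any vertex `x ∉ {a, v, b}` of `F`: `(v, x)` is not a tight dart — the
only vertices of a face tight-adjacent to `v` are its two walk-neighbours. -/
theorem CensusRows.not_mem_darts_of_oface_diagonal (h : CensusRows c)
    {F : Finset (Fin 14 × Fin 14)} (hF : F ∈ ofaces c) {a v b x : Fin 14} (hav : (a, v) ∈ F)
    (hvb : (v, b) ∈ F) (hx : x ∈ F.image Prod.fst) (hxa : x ≠ a) (hxv : x ≠ v) (hxb : x ≠ b) :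
    (v, x) ∉ darts c := by
  obtain ⟨hD3, -, -⟩ := h.intruderDist_bounds
  have hFq : ofaceOf c (a, v) = F := h.isGapConfig.ofaceOf_eq_of_mem_ofaces hD3 hF hav
  have hq : (a, v) ∈ darts c := h.isGapConfig.subset_darts_of_mem_ofaces hD3 hF hav
  -- `b` is the walk-successor of `v`
  have hb : b = onextNbr c v a :=
    h.oface_out_unique hF hvb (h.ofaceSucc_mem_of_mem_ofaces hF hav)
  rw [← hFq] at hx
  obtain ⟨n, hn, hnx⟩ := mem_image_fst_ofaceOf.1 hx
  have hn3 : 3 ≤ n := by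
    by_contra hlt
    have hn012 : n = 0 ∨ n = 1 ∨ n = 2 := by omega
    rcases hn012 with rfl | rfl | rfl
    · simp only [iterate_zero, id_eq] at hnx; exact hxa hnx.symm
    · exact hxv hnx.symm
    · rw [(fst_iterate_ofaceSucc_two c (a, v)).2] at hnx
      exact hxb (hnx.symm.trans hb.symm)
  intro hvx
  have := h.not_mem_tightNbrs_of_oface hq hn3 hn
  rw [hnx] at this
  exact this (snd_mem_tightNbrs_of_mem_darts hvx)

/-- **Diagonals of a face are loose (metric form):** with the notation of
`CensusRows.not_mem_darts_of_oface_diagonal`, `1 < dist (c v) (c x)` — non-adjacent corners of a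
face are strictly more than the contact distance apart (R-pent / R-hex: non-adjacent `x`-corners
`> 60°` apart, the hole to non-adjacent `x`-corners `> ρ*`). -/
theorem CensusRows.one_lt_dist_of_oface_diagonal (h : CensusRows c)
    {F : Finset (Fin 14 × Fin 14)} (hF : F ∈ ofaces c) {a v b x : Fin 14} (hav : (a, v) ∈ F)
    (hvb : (v, b) ∈ F) (hx : x ∈ F.image Prod.fst) (hxa : x ≠ a) (hxv : x ≠ v) (hxb : x ≠ b) :
    1 < dist (c v) (c x) := by
  obtain ⟨hD3, -, -⟩ := h.intruderDist_bounds
  have hv0 : v ≠ 0 :=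
    (mem_darts.1 (h.isGapConfig.subset_darts_of_mem_ofaces hD3 hF hvb)).1
  have hx0 : x ≠ 0 := by
    obtain ⟨r, hrF, rfl⟩ := Finset.mem_image.1 hx
    exact (mem_darts.1 (h.isGapConfig.subset_darts_of_mem_ofaces hD3 hF hrF)).1
  have h1 : (1 : ℝ) ≤ dist (c v) (c x) := h.isGapConfig.1 v x (Ne.symm hxv)
  refine lt_of_le_of_ne h1 fun heq => ?_
  exact h.not_mem_darts_of_oface_diagonal hF hav hvb hx hxa hxv hxb
    (mem_darts.2 ⟨hv0, hx0, Ne.symm hxv, heq.symm⟩)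

end Summit.Ventures.Crystal3D
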